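import Mathlib
import Summits.Ventures.PercRepro2.Defs
import Summits.Ventures.PercRepro2.TriDisagreement
import Summits.Ventures.PercRepro2.TriDisagreementPinned
import Summits.Ventures.PercRepro2.MM0Sector
import Summits.Ventures.PercRepro2.MM0Pinned

/-!
# Row 2′MM0: `PinnedMM0` is the typed-count statement of p1's `typedCount`
(blind cell PercRepro2, night-1 g4; the «p1 link» of ASSIGNMENTS v11.6x)

`MM0Pinned.patternCoeff3 pat` sums the three-copy kernel over the ordered triples with order
statistics `pat = (lo, med, hi)`; p1's `typedCount F z τ K` sums `K` over the triples agreeing with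
`z` off `F` and having exactly `τ e` open copies at each `e ∈ F`. For a CHAIN pattern
(`lo ≤ med ≤ hi`) the two index sets coincide with `F = {e | lo e ≠ hi e}` (the edges open in some
but not all copies), `z = lo` and `τ e = lo e + med e + hi e` (`stats_eq_iff`, a statement about three
Booleans decided by `decide`):

* `patternCoeff3_eq_typedCount`: `patternCoeff3 pat = typedCount (patFree pat) pat.1 (patType pat) K`;
* non-chain patterns carry no triple (`patternCoeff3_eq_zero_of_not_isChain`);
* **`pinnedMM0_iff_typedCount`**: `PinnedMM0 ↔ ∀ F z τ, (∀ e ∈ F, τ e = 1 ∨ τ e = 2) →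
  typedCount F z τ (tripleKernel …) ≤ 0` — the weight-free statement of row 2′MM0 in the vocabulary
  of the cell's typed ladder (`TriDisagreementPinned`, night-3's typed reduction rules).
-/

namespace Summit.Ventures.PercRepro2
namespace MM0Pinned

open MM0Sector

section Patterns

variable {E : Type*} [Fintype E] [DecidableEq E]

/-- The free edges of a pattern: open in some but not all of the three copies. -/
def patFree (pat : Config E × Config E × Config E) : Finset E :=
  Finset.univ.filter fun e => pat.1 e ≠ pat.2.2 e

/-- The type (number of open copies) of a pattern at an edge. -/
def patType (pat : Config E × Config E × Config E) (e : E) : ℕ :=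
  (pat.1 e).toNat + (pat.2.1 e).toNat + (pat.2.2 e).toNat

/-- A pattern is a chain when `lo ≤ med ≤ hi`. -/
def IsChain (pat : Config E × Config E × Config E) : Prop := pat.1 ≤ pat.2.1 ∧ pat.2.1 ≤ pat.2.2

omit [Fintype E] [DecidableEq E] in
/-- The order statistics of three Booleans against a chain, edgewise. -/
lemma bool_stats (a b c l m h : Bool) (hlm : l ≤ m) (hmh : m ≤ h) :
    ((a && b && c) = l ∧ ((a && b) || ((a || b) && c)) = m ∧ (a || b || c) = h) ↔
      (if l = h then a = l ∧ b = l ∧ c = l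
        else a.toNat + b.toNat + c.toNat = l.toNat + m.toNat + h.toNat) := by
  revert a b c l m h
  decide

omit [Fintype E] [DecidableEq E] in
/-- `lo` edgewise. -/
lemma lo_apply (x y w : Config E) (e : E) : lo x y w e = (x e && y e && w e) := by
  rw [lo_eq]
  simp only [Pi.inf_apply]
  cases x e <;> cases y e <;> cases w e <;> rfl

omit [Fintype E] [DecidableEq E] in
/-- `med` edgewise. -/
lemma med_apply (x y w : Config E) (e : E) : med x y w e = ((x e && y e) || ((x e || y e) && w e)) := by
  simp only [med, Pi.inf_apply, Pi.sup_apply]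
  cases x e <;> cases y e <;> cases w e <;> rfl

omit [Fintype E] [DecidableEq E] in
/-- `sup` edgewise. -/
lemma sup3_apply (x y w : Config E) (e : E) : (x ⊔ y ⊔ w) e = (x e || y e || w e) := by
  simp only [Pi.sup_apply]
  cases x e <;> cases y e <;> cases w e <;> rfl

omit [Fintype E] [DecidableEq E] in
/-- The order statistics are always a chain. -/
lemma isChain_stats (x y w : Config E) : IsChain (lo x y w, med x y w, x ⊔ y ⊔ w) := by
  refine ⟨fun e => ?_, fun e => ?_⟩
  · change lo x y w e ≤ med x y w e
    rw [lo_apply, med_apply]; cases x e <;> cases y e <;> cases w e <;> decide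
  · change med x y w e ≤ (x ⊔ y ⊔ w) e
    rw [med_apply, sup3_apply]; cases x e <;> cases y e <;> cases w e <;> decide

omit [DecidableEq E] in
/-- A triple has order statistics `pat` (a chain) iff it agrees with `lo` off the free edges and has the
right number of open copies on them. -/
lemma stats_eq_iff {pat : Config E × Config E × Config E} (hpat : IsChain pat) (x y w : Config E) :
    (lo x y w, med x y w, x ⊔ y ⊔ w) = pat ↔
      ((∀ e, e ∉ patFree pat → x e = pat.1 e ∧ y e = pat.1 e ∧ w e = pat.1 e) ∧
        ∀ e ∈ patFree pat, openCount x y w e = patType pat e) := by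
  obtain ⟨l, m, h⟩ := pat
  simp only [Prod.mk.injEq, funext_iff, lo_apply, med_apply, sup3_apply, patFree, patType,
    Finset.mem_filter, Finset.mem_univ, true_and, openCount, not_not]
  constructor
  · intro hh
    refine ⟨fun e he => ?_, fun e he => ?_⟩
    · have := (bool_stats (x e) (y e) (w e) (l e) (m e) (h e) (hpat.1 e) (hpat.2 e)).1
        ⟨hh.1 e, hh.2.1 e, hh.2.2 e⟩
      rw [if_pos he] at this
      exact this
    · have := (bool_stats (x e) (y e) (w e) (l e) (m e) (h e) (hpat.1 e) (hpat.2 e)).1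
        ⟨hh.1 e, hh.2.1 e, hh.2.2 e⟩
      rw [if_neg he] at this
      exact this
  · intro hh
    have key : ∀ e, (x e && y e && w e) = l e ∧ ((x e && y e) || ((x e || y e) && w e)) = m e ∧
        (x e || y e || w e) = h e := by
      intro e
      rw [bool_stats (x e) (y e) (w e) (l e) (m e) (h e) (hpat.1 e) (hpat.2 e)]
      by_cases he : l e = h e
      · rw [if_pos he]; exact hh.1 e he
      · rw [if_neg he]; exact hh.2 e he
    exact ⟨fun e => (key e).1, fun e => (key e).2.1, fun e => (key e).2.2⟩

end Patterns

section Bridge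

variable {V : Type*} {E : Type*} [Fintype E] [DecidableEq E] [Fintype V] [DecidableEq V]
  {R : Type*} [CommRing R]

omit [Fintype V] [DecidableEq V] in
/-- A pattern coefficient of a chain pattern is the typed count of p1's `typedCount` at the free
edges, pinned to `lo`, with the pattern's types. -/
theorem patternCoeff3_eq_typedCount (ends : E → Sym2 V) (s t b u w v : V)
    {pat : Config E × Config E × Config E} (hpat : IsChain pat) :
    patternCoeff3 (R := R) ends s t b u w v pat =
      typedCount (patFree pat) pat.1 (patType pat) (tripleKernel (R := R) ends s t b u w v) := by
  unfold patternCoeff3 typedCount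
  simp only [Fintype.sum_prod_type]
  refine Finset.sum_congr rfl fun x _ => Finset.sum_congr rfl fun y _ =>
    Finset.sum_congr rfl fun z _ => ?_
  by_cases hc : (lo x y z, med x y z, x ⊔ y ⊔ z) = pat
  · rw [if_pos hc, if_pos ((stats_eq_iff hpat x y z).1 hc)]
  · rw [if_neg hc, if_neg (fun h => hc ((stats_eq_iff hpat x y z).2 h))]

omit [Fintype V] [DecidableEq V] in
/-- A pattern that is not a chain carries no triple. -/
theorem patternCoeff3_eq_zero_of_not_isChain (ends : E → Sym2 V) (s t b u w v : V)
    {pat : Config E × Config E × Config E} (hpat : ¬ IsChain pat) :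
    patternCoeff3 (R := R) ends s t b u w v pat = 0 := by
  unfold patternCoeff3
  refine Finset.sum_eq_zero fun xyz _ => ?_
  rw [if_neg]
  intro h
  exact hpat (h ▸ isChain_stats xyz.1 xyz.2.1 xyz.2.2)

omit [Fintype V] [DecidableEq V] in
/-- `typedCount` only depends on `z` off `F` and on `τ` on `F`. -/
lemma typedCount_congr (F : Finset E) {z z' : Config E} {τ τ' : E → ℕ}
    (hz : ∀ e, e ∉ F → z e = z' e) (hτ : ∀ e ∈ F, τ e = τ' e)
    (K : Config E → Config E → Config E → R) :
    typedCount F z τ K = typedCount F z' τ' K := by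
  unfold typedCount
  refine Finset.sum_congr rfl fun x _ => Finset.sum_congr rfl fun y _ =>
    Finset.sum_congr rfl fun w _ => ?_
  have hiff : ((∀ e, e ∉ F → x e = z e ∧ y e = z e ∧ w e = z e) ∧ ∀ e ∈ F, openCount x y w e = τ e) ↔
      ((∀ e, e ∉ F → x e = z' e ∧ y e = z' e ∧ w e = z' e) ∧ ∀ e ∈ F, openCount x y w e = τ' e) := by
    constructor
    · rintro ⟨h1, h2⟩
      exact ⟨fun e he => by rw [← hz e he]; exact h1 e he, fun e he => by rw [← hτ e he]; exact h2 e he⟩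
    · rintro ⟨h1, h2⟩
      exact ⟨fun e he => by rw [hz e he]; exact h1 e he, fun e he => by rw [hτ e he]; exact h2 e he⟩
  by_cases hc : (∀ e, e ∉ F → x e = z e ∧ y e = z e ∧ w e = z e) ∧ ∀ e ∈ F, openCount x y w e = τ e
  · rw [if_pos hc, if_pos (hiff.1 hc)]
  · rw [if_neg hc, if_neg (fun h => hc (hiff.2 h))]

variable [LinearOrder R]

omit [Fintype V] [DecidableEq V] in
/-- **`PinnedMM0` in typed-count form**: every pattern coefficient is `≤ 0` iff every typed count of
the three-copy kernel with types in `{1, 2}` on the free edges is `≤ 0`. -/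
theorem pinnedMM0_iff_typedCount (ends : E → Sym2 V) (s t b u w v : V) :
    PinnedMM0 (R := R) ends s t b u w v ↔
      ∀ (F : Finset E) (z : Config E) (τ : E → ℕ), (∀ e ∈ F, τ e = 1 ∨ τ e = 2) →
        typedCount F z τ (tripleKernel (R := R) ends s t b u w v) ≤ 0 := by
  constructor
  · intro hpin F z τ hτ
    -- the chain pattern with free set `F`, pinned to `z`, of type `τ`
    let pat : Config E × Config E × Config E :=
      (fun e => if e ∈ F then false else z e, fun e => if e ∈ F then decide (τ e = 2) else z e,
        fun e => if e ∈ F then true else z e)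
    have hchain : IsChain pat := by
      refine ⟨fun e => ?_, fun e => ?_⟩ <;> simp only [pat] <;> split_ifs <;> simp
    have hF : patFree pat = F := by
      ext e
      simp only [patFree, Finset.mem_filter, Finset.mem_univ, true_and, pat]
      split_ifs with he <;> simp [he]
    have hz : ∀ e, e ∉ F → pat.1 e = z e := fun e he => by simp [pat, he]
    have hτ' : ∀ e ∈ F, patType pat e = τ e := by
      intro e he
      simp only [patType, pat, if_pos he]
      rcases hτ e he with h | h <;> simp [h]
    have := hpin pat
    rw [patternCoeff3_eq_typedCount ends s t b u w v hchain, hF] at this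
    rw [typedCount_congr F (fun e he => (hz e he).symm) (fun e he => (hτ' e he).symm)]
    exact this
  · intro htc pat
    by_cases hchain : IsChain pat
    · rw [patternCoeff3_eq_typedCount ends s t b u w v hchain]
      refine htc _ _ _ fun e he => ?_
      simp only [patFree, Finset.mem_filter, Finset.mem_univ, true_and] at he
      simp only [patType]
      have h1 := hchain.1 e
      have h2 := hchain.2 e
      revert h1 h2 he
      cases pat.1 e <;> cases pat.2.1 e <;> cases pat.2.2 e <;> simp
    · rw [patternCoeff3_eq_zero_of_not_isChain ends s t b u w v hchain]

end Bridge

end MM0Pinned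
end Summit.Ventures.PercRepro2
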